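import Literature.NumberTheory.EllipticCurves.LocalKummerMap
import Literature.NumberTheory.EllipticCurves.SelmerTorsionBaseChangeCongr
import Literature.NumberTheory.EllipticCurves.TwoDescentOneRootGalois
import HarnessLib

/-!
# `resTorsion` versus `res` on `H¹(·, E[n])`, and restriction of Kummer classes

Bridges between the two restriction currencies of the tree for the torsion module `E[n]`:
`resTorsion W E n : H¹(K, E[n]) → H¹(E, E_E[n])` (coefficients transported to the base change,
`SelmerTorsionRestriction.lean`) and `galoisCohomology.res (W.torsionGaloisModule n) E 1 :
H¹(K, E[n]) → H¹(Γ_E, E[n](K̄)|_{Γ_E})` (coefficients kept, `KummerSelmerStructure.lean`), which differ by the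
inverse torsion transfer `H¹(torsionTransferInvHom)` (`LocalKummerIsotropyTransport.lean`,
`LocalKummerMap.lean`):

* `baseChangeGeomPointsEquiv_localPointsEquivGeomPoints` — the two identifications
  `E(K̄_E) = E_E(K̄_E)` of the tree are mutually inverse (both are the identity on coordinates);
* `torsionTransferEquiv_eq_torsionBaseChangeMap` — the torsion transfer IS the coefficient map of
  `resTorsion`;
* `cohomologyMap_torsionTransferInvHom_resTorsion` — **`H¹(A⁻¹) ∘ resTorsion = res`**;
* `resTorsion_kummerMapTorsion` — **restriction of a global Kummer class is the Kummer class of the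
  base-changed point**: `resTorsion W E n (κ_W P) = κ_{W⁄E} (P_E)` (Silverman X.§4, left square of (**)).

## References
* [SilvermanAEC2009] J. H. Silverman, *The Arithmetic of Elliptic Curves*, 2nd ed., X.§4 (diagram (**)), VIII.§2.
* [SerreGaloisCohomology1997] J.-P. Serre, *Galois Cohomology*, I.§2.4, II.§1.1.
-/

noncomputable section

open scoped Classical

universe u

namespace WeierstrassCurve

open CategoryTheory Literature.NumberTheory.EllipticCurves Literature.NumberTheory.GaloisRepresentations Field

variable {K : Type u} [Field K] (W : WeierstrassCurve K) (E : Type u) [Field E] [Algebra K E]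

/-- The tree's two identifications `E_E(K̄_E) ≃ E(K̄_E)` (`baseChangeGeomPointsEquiv`, across
`baseChange_baseChange_algebraicClosure`) and `E(K̄_E) ≃ E_E(K̄_E)` (`localPointsEquivGeomPoints`, across
`baseChange_baseChange`) are mutually inverse: both are the identity on coordinates. [folklore]
[cite: SilvermanAEC2009, VIII.§1] -/
theorem baseChangeGeomPointsEquiv_localPointsEquivGeomPoints (P : localPoints W E) :
    W.baseChangeGeomPointsEquiv E (localPointsEquivGeomPoints W E P) = P := by
  rcases P with _ | ⟨x, y, h⟩
  · change W.baseChangeGeomPointsEquiv E (localPointsEquivGeomPoints W E 0) = 0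
    rw [map_zero, map_zero]
  · change W.baseChangeGeomPointsEquiv E (pointsCongr W E (AlgebraicClosure E) (.some x y h)) = _
    rw [pointsCongr, Affine.Point.congrEquiv_some]
    exact W.baseChangeGeomPointsEquiv_some E _

/-- The local point of a rational point, two ways: the image of `P ∈ E(K)` in `E(K̄_E)` under the chosen
embedding is the geometric point of its base change `P_E ∈ (W⁄E)(E)` (same coordinates). [folklore]
[cite: SilvermanAEC2009, VIII.§1] -/
theorem pointsMap_toGeomPoints_eq (P : W.toAffine.Point) :
    pointsMap W E (toGeomPoints W P) =
      W.baseChangeGeomPointsEquiv E (toGeomPoints (W.baseChange E) (Affine.Point.baseChange (W' := W) K E P)) := by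
  rcases P with _ | ⟨x, y, h⟩
  · change pointsMap W E (toGeomPoints W 0) = W.baseChangeGeomPointsEquiv E (toGeomPoints (W.baseChange E)
      (Affine.Point.baseChange (W' := W) K E 0))
    rw [map_zero, map_zero, map_zero, map_zero, map_zero]
  · have hx : closureEmb (K := K) E (algebraMap K (AlgebraicClosure K) x) =
        algebraMap E (AlgebraicClosure E) (algebraMap K E x) := by
      rw [AlgHom.commutes, IsScalarTower.algebraMap_apply K E (AlgebraicClosure E)]
    have hy : closureEmb (K := K) E (algebraMap K (AlgebraicClosure K) y) =
        algebraMap E (AlgebraicClosure E) (algebraMap K E y) := by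
      rw [AlgHom.commutes, IsScalarTower.algebraMap_apply K E (AlgebraicClosure E)]
    obtain ⟨h1', h1⟩ : ∃ h', pointsMap W E (toGeomPoints W (.some x y h)) =
        (show localPoints W E from .some (closureEmb (K := K) E (algebraMap K (AlgebraicClosure K) x))
          (closureEmb (K := K) E (algebraMap K (AlgebraicClosure K) y)) h') :=
      ⟨_, rfl⟩
    obtain ⟨h2', h2⟩ : ∃ h', toGeomPoints (W.baseChange E) (Affine.Point.baseChange (W' := W) K E (.some x y h)) =
        (.some (algebraMap E (AlgebraicClosure E) (algebraMap K E x))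
          (algebraMap E (AlgebraicClosure E) (algebraMap K E y)) h' : geomPoints (W.baseChange E)) :=
      ⟨_, rfl⟩
    have h3 := (congrArg (W.baseChangeGeomPointsEquiv E) h2).trans (W.baseChangeGeomPointsEquiv_some E h2')
    refine h1.trans (Eq.trans ?_ h3.symm)
    dsimp only
    change (Affine.Point.some _ _ _ : (W.baseChange (AlgebraicClosure E)).toAffine.Point) = Affine.Point.some _ _ _
    rw [Affine.Point.some.injEq]
    exact ⟨hx, hy⟩

variable {E} [CharZero K] [W.IsElliptic] {n : ℤ} (hn : n ≠ 0)

/-- **The torsion transfer is the coefficient map of `resTorsion`**: `torsionTransferEquiv T` and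
`torsionBaseChangeMap W E n T` have the same underlying point of `E_E(K̄_E)` (the image of `T` under the
chosen embedding, read on the base change). [cite: SerreGaloisCohomology1997, II.§1.1] -/
theorem torsionTransferEquiv_eq_torsionBaseChangeMap (T : geomTorsion W n) :
    W.torsionTransferEquiv (E := E) hn T = torsionBaseChangeMap W E n T := by
  apply Subtype.ext
  rw [coe_torsionTransferEquiv_apply, coe_torsionBaseChangeMap]
  apply (W.baseChangeGeomPointsEquiv E).injective
  rw [AddEquiv.apply_symm_apply, baseChangeGeomPointsEquiv_localPointsEquivGeomPoints]

/-- **`H¹(A⁻¹) ∘ resTorsion = res`**: transporting `resTorsion W E n c ∈ H¹(E, E_E[n])` back along the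
inverse torsion transfer gives the plain restriction `res c ∈ H¹(Γ_E, E[n](K̄)|_{Γ_E})` — on cocycles both
are `σ ↦ φ(σ|_{K̄})`. [cite: SerreGaloisCohomology1997, I.§2.4] -/
theorem cohomologyMap_torsionTransferInvHom_resTorsion (c : galH1Torsion W n) :
    cohomologyMap (W.torsionTransferInvHom (E := E) hn) 1 (resTorsion W E n c) =
      galoisCohomology.res (W.torsionGaloisModule n) E 1 c := by
  obtain ⟨φ, rfl⟩ := oneCocycleClass_surjective _ c
  have hres : resTorsion W E n (oneCocycleClass _ φ) =
      oneCocycleClass _ (contOneCocycles.pullback (resGal (K := K) E)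
        (resHomOfEquivariant (resGal (K := K) E) (torsionBaseChangeMap W E n)
          (torsionBaseChangeMap_smul W E n)) φ) :=
    map_oneCocycleClass (X := discreteTopRep (absoluteGaloisGroup K) (geomTorsion W n))
      (Y := discreteTopRep (absoluteGaloisGroup E) (geomTorsion (W.baseChange E) n)) (resGal (K := K) E)
      (resHomOfEquivariant (resGal (K := K) E) (torsionBaseChangeMap W E n) (torsionBaseChangeMap_smul W E n)) φ
  rw [hres]
  change cohomologyMap (W.torsionTransferInvHom (E := E) hn) 1
      (oneCocycleClass ((W.baseChange E).torsionGaloisModule n).toTopRep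
        (contOneCocycles.pullback (resGal (K := K) E)
          (X := discreteTopRep (absoluteGaloisGroup K) (geomTorsion W n))
          (Y := ((W.baseChange E).torsionGaloisModule n).toTopRep)
          (resHomOfEquivariant (resGal (K := K) E) (torsionBaseChangeMap W E n)
            (torsionBaseChangeMap_smul W E n)) φ)) = _
  rw [cohomologyMap_oneCocycleClass, res_torsionGaloisModule_oneCocycleClass]
  congr 1
  apply Subtype.ext
  ext σ : 1
  rw [contOneCocycles.pullback_apply, contOneCocycles.pullback_apply, contOneCocycles.pullback_apply]
  change (W.torsionTransferInvHom (E := E) hn).hom (torsionBaseChangeMap W E n (φ.1 (resGal (K := K) E σ))) =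
    φ.1 (absGaloisRestrict K E σ)
  rw [torsionTransferInvHom_apply, ← torsionTransferEquiv_eq_torsionBaseChangeMap W hn,
    AddEquiv.symm_apply_apply, resGal_eq_absGaloisRestrict]

/-- **Restriction of a global Kummer class is the Kummer class of the base-changed point**: for
`P ∈ E(K)` and a `K`-field `E`, `resTorsion W E n (κ_W(P)) = κ_{W⁄E}(P_E)` in `H¹(E, E_E[n])` (any admissible
choices of `n`-th roots `hdiv`, `hdiv'`). Silverman, *AEC*, X.§4 (commutativity of the left square of (**)).
[cite: SilvermanAEC2009, X.§4 diagram (**)] -/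
theorem resTorsion_kummerMapTorsion [CharZero E] (hn : n ≠ 0)
    (hdiv : ∀ P : geomPoints W, ∃ Q : geomPoints W, n • Q = P)
    (hdiv' : ∀ P : geomPoints (W.baseChange E), ∃ Q : geomPoints (W.baseChange E), n • Q = P)
    (P : W.toAffine.Point) :
    resTorsion W E n (kummerMapTorsion W n hdiv P) =
      kummerMapTorsion (W.baseChange E) n hdiv' (Affine.Point.baseChange (W' := W) K E P) := by
  haveI : (W.baseChange E).IsElliptic := W.isElliptic_baseChange E
  -- `H¹(A⁻¹)` is injective (it is the equivalence `galH1TorsionBaseChangeEquiv`)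
  apply (W.galH1TorsionBaseChangeEquiv E hn).injective
  rw [galH1TorsionBaseChangeEquiv_apply, galH1TorsionBaseChangeEquiv_apply,
    cohomologyMap_torsionTransferInvHom_resTorsion, ← localKummerMap_eq_cohomologyMap_kummerMapTorsion]
  -- both sides are the local Kummer class of the image point
  obtain ⟨Q, hQ⟩ := hdiv (toGeomPoints W P)
  have hQfix : n • Q ∈ MulAction.fixedPoints (absoluteGaloisGroup K) (geomPoints W) := by
    rw [hQ]; exact toGeomPoints_mem_fixedPoints W P
  rw [kummerMapTorsion_apply, kummerMapTorsionFun_eq W n hdiv P Q hQ,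
    W.res_kummerClassTorsion n hn Q hQfix (zsmul_pointsMap_mem_fixedPoints (W := W) (n := n) (E := E) Q hQfix)]
  symm
  refine W.localKummerMap_eq_localKummerClass E hn _ _ _ ?_
  rw [← map_zsmul, hQ, pointsMap_toGeomPoints_eq]

end WeierstrassCurve

end
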